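import Summits.ResolutionOfSingularities.ResolutionOfSingularities.Theorems.EquisingularLiftEquisingularLiftOrdinaryPointsJacobianTransport
import HarnessLib

/-!
# [OURS] ONE ORDINARY MULTIPLE POINT ANYWHERE — intrinsic (translated-chart) hypothesis, classical Jacobian condition, both currencies
# (cruxes `EquisingularLift` stmt-…-15660 / `EquisingularLiftNat(Three)` stmt-…-20038 / -20148; every dimension, every characteristic)

[OURS · leafhand-res-equisingularlift-7 g1, 2026-08-31; cell `pub/decomp-res`] AI-produced, weaker than expert review; NOT a statement of any manuscript;
nothing here proves resolution of singularities.  DEF-FREE helper; no `sorry`; standard axioms; ZERO named hypotheses.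

T-ORD (✓ `OrdPoint.elNatAt_ordinaryPoint`, seat res-D-pv-013) treats an ordinary multiple point AT THE VERTEX `[1:0:…:0]`.  Here the point is ANYWHERE,
`P = [b]` with `b_{c₀} = 1`, and the hypotheses are the ones a geometer writes down: (ordF) the chart equation `F(x_{c₀} := 1)` TRANSLATED to `P`,
`f(y + b') = Φ + Ψ` with `Φ` a nonsingular form of degree `μ ≥ 1` and `Ψ ∈ (y)^{μ+1}`; (jacF) every `b₁ ≠ 0` with `F(b₁) = 0`, `∇F(b₁) = 0` is proportional
to `b`.  The elementary substitution `x_i ↦ x_i + b_i x_{c₀}` (`i ≠ c₀`) moves `P` to the vertex `e_{c₀}`, turns the vertex chart into the translated chart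
VERBATIM (`dehomogenize_shear_eq_translate`), and ✓ `MultiOrd.jacobian_of_linSubst` carries (jacF):

* `MultiOrd.shear`, `MultiOrd.unshear` are NOT definitions but the explicit substitution tuples written inline; lemmas `isHomogeneous_shear`,
  `aeval_unshear_shear`, `aeval_shear_unshear`, `dehomogenize_shear_eq_translate`;
* ★★ `MultiOrd.elNatAt_of_ordinaryPoint_at` — **EL♮ (`ELNatAt`) for every `(H, ι)`, `range ι = V₊(F)`, `F` a prime form over `K = K̄` of characteristic `p`
  whose only singular point is an ORDINARY MULTIPLE POINT `P = [b]` (translated-chart hypothesis)** — any dimension, any degree;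
* ★★ `StrataSplit.blowupModel_of_ordinaryPoint_at` — the same `H` has a regular blow-up model (conclusion of the OPEN residual `stub_blowupModel_ge_five`),
  `K = K̄` of any characteristic.

Honest label: closes no registered stub.

References: [Hartshorne1977, I Thm. 5.1, I Ex. 5.8, II Example 7.1.1]; [StacksProject, Tag 080A].
-/

set_option linter.dupNamespace false -- mandated namespace `Summit.<Summit>.<Problem>` of this single-conjunct summit

noncomputable section

open CategoryTheory CategoryTheory.Limits AlgebraicGeometry TopologicalSpace
open MvPolynomial
open Literature.AlgebraicGeometry.Resolution
open Literature.AlgebraicGeometry.Motives Literature.AlgebraicGeometry.Motives.SmoothHypersurface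
open Literature.AlgebraicGeometry.Motives.ProjectiveSpace

namespace Summit.ResolutionOfSingularities.ResolutionOfSingularities.Cruxes.EquisingularLiftNat.Sections

namespace MultiOrd

variable {K : Type} [Field K] {N : ℕ} (c₀ : Fin (N + 1)) (b : Fin (N + 1) → K)

/-! ## The shear `x_i ↦ x_i + b_i·x_{c₀}` (`i ≠ c₀`), `x_{c₀} ↦ x_{c₀}` and its inverse -/

/-- The shear `τ'` (`x_i ↦ x_i + b_i x_{c₀}` for `i ≠ c₀`) consists of linear forms. [folklore] -/
theorem isHomogeneous_shear (s : K) (i : Fin (N + 1)) :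
    (if i = c₀ then (X c₀ : MvPolynomial (Fin (N + 1)) K) else X i + C (s * b i) * X c₀).IsHomogeneous 1 := by
  split_ifs
  · exact isHomogeneous_X K c₀
  · refine (isHomogeneous_X K i).add ?_
    have h := (isHomogeneous_C (Fin (N + 1)) (s * b i)).mul (isHomogeneous_X K c₀)
    rwa [zero_add] at h

/-- `σ_{τ} (τ' i) = x_i` for the shear `τ'` (parameter `s = 1`) and the inverse shear `τ` (parameter `s = -1`), and symmetrically. [folklore] -/
theorem aeval_shear_shear (s : K) (i : Fin (N + 1)) :
    aeval (fun i : Fin (N + 1) => if i = c₀ then (X c₀ : MvPolynomial (Fin (N + 1)) K) else X i + C (-s * b i) * X c₀)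
      (if i = c₀ then (X c₀ : MvPolynomial (Fin (N + 1)) K) else X i + C (s * b i) * X c₀) = X i := by
  split_ifs with h
  · subst h
    rw [aeval_X, if_pos rfl]
  · rw [map_add, map_mul, aeval_C, aeval_X, aeval_X, if_neg h, if_pos rfl, MvPolynomial.algebraMap_eq]
    simp only [map_neg, map_mul, neg_mul]
    ring

/-- **The vertex chart of the sheared form is the translated chart**: `(σ_{τ'} F)(x_{c₀} := 1)(y) = F(x_{c₀} := 1)(y + b')` when `b_{c₀} = 1`, where
`b'_j = b_{c₀.succAbove j}` — both are `F` evaluated at `x_{c₀} = 1`, `x_{c₀.succAbove j} = y_j + b'_j`. [folklore] -/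
theorem dehomogenize_shear_eq_translate (F : MvPolynomial (Fin (N + 1)) K) :
    ProjectiveSpace.dehomogenize K c₀
        (aeval (fun i : Fin (N + 1) => if i = c₀ then (X c₀ : MvPolynomial (Fin (N + 1)) K) else X i + C (1 * b i) * X c₀) F) =
      aeval (fun j : Fin N => (X j : MvPolynomial (Fin N) K) + C (b (c₀.succAbove j))) (ProjectiveSpace.dehomogenize K c₀ F) := by
  rw [ProjectiveSpace.dehomogenize, ← AlgHom.comp_apply, ← AlgHom.comp_apply, MvPolynomial.comp_aeval, MvPolynomial.comp_aeval]
  congr 2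
  funext i
  rcases Fin.eq_self_or_eq_succAbove c₀ i with rfl | ⟨j, rfl⟩
  · simp
  · rw [if_neg (Fin.succAbove_ne c₀ j)]
    simp [Fin.insertNth_apply_succAbove, Fin.insertNth_apply_same]

/-- **(jacF) «every singular point is proportional to `b`» is (jac) for the shear**: `τ_i(b₁) = b₁_i − b_i b₁_{c₀} = 0` for `i ≠ c₀`. [folklore] -/
theorem jacobianF_of_proportional (S : List (Fin (N + 1))) (hc₀ : c₀ ∈ S) (F : MvPolynomial (Fin (N + 1)) K)
    (hjacF : ∀ b₁ : Fin (N + 1) → K, b₁ ≠ 0 → eval b₁ F = 0 → (∀ j, eval b₁ (pderiv j F) = 0) → ∀ i, b₁ i = b₁ c₀ * b i) :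
    ∀ b₁ : Fin (N + 1) → K, b₁ ≠ 0 → eval b₁ F = 0 → (∀ j, eval b₁ (pderiv j F) = 0) →
      ∃ c ∈ S, ∀ i, i ≠ c → eval b₁ (if i = c₀ then (X c₀ : MvPolynomial (Fin (N + 1)) K) else X i + C (-1 * b i) * X c₀) = 0 := by
  intro b₁ hb₁ h0 hd
  refine ⟨c₀, hc₀, fun i hi => ?_⟩
  rw [if_neg hi]
  simp only [map_add, map_mul, eval_X, eval_C]
  rw [hjacF b₁ hb₁ h0 hd i]
  ring

/-- ★★ **EL♮ FOR A HYPERSURFACE WHOSE ONLY SINGULAR POINT IS AN ORDINARY MULTIPLE POINT, ANYWHERE — every dimension, degree and characteristic.**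
`K = K̄` of characteristic `p`; `ι : H ↪ ℙ^{m+2}_K` a closed immersion with `range ι = V₊(F)`, `F` a prime form; `P = [b]`, `b_{c₀} = 1`;
(ordF) the translated chart `F(x_{c₀} := 1)(y + b') = Φ + Ψ`, `Φ` a NONSINGULAR form of degree `μ ≥ 1`, `Ψ ∈ (y)^{μ+1}`; (jacF) every `b₁ ≠ 0` with
`F(b₁) = 0` and `∇F(b₁) = 0` is `b₁ = b₁_{c₀}·b`.  Then `Theorems.EquisingularLift.ELNatAt p K (m+2) H ι` — witness `O = 𝕎(K)`, one blow-up of `ℙ^{m+2}_O`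
along the `O`-point through `P` (in sheared coordinates).  ✓ `elNatAt_of_linSubst_ordinaryPoints_of_jacobian'` with the shear.
[OURS · L1 W4.5b] [cite: Hartshorne1977, I Thm. 5.1, II Example 7.1.1] -/
theorem elNatAt_of_ordinaryPoint_at (p : ℕ) (hp : p.Prime) [CharP K p] [IsAlgClosed K] {m : ℕ}
    {H : Scheme.{0}} (ι : H ⟶ (projectiveSpace (m + 1 + 1) K).left) [IsClosedImmersion ι]
    (F : MvPolynomial (Fin (m + 1 + 1 + 1)) K) {d : ℕ} (hF : F.IsHomogeneous d) (hFp : Prime F)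
    (hrange : letI := MvPolynomial.gradedAlgebra (σ := Fin (m + 1 + 1 + 1)) (R := K)
      Set.range ι = {x : Proj (homogeneousSubmodule (Fin (m + 1 + 1 + 1)) K) | F ∈ x.asHomogeneousIdeal})
    (c : Fin (m + 1 + 1 + 1)) (pt : Fin (m + 1 + 1 + 1) → K)
    (hordF : ∃ (μ : ℕ) (Φ Ψ : MvPolynomial (Fin (m + 2)) K), 1 ≤ μ ∧ Φ.IsHomogeneous μ ∧ IsNonsingularForm K Φ ∧
      Ψ ∈ Ideal.span (Set.range (X : Fin (m + 2) → MvPolynomial (Fin (m + 2)) K)) ^ (μ + 1) ∧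
        aeval (fun j : Fin (m + 2) => (X j : MvPolynomial (Fin (m + 2)) K) + C (pt (c.succAbove j))) (ProjectiveSpace.dehomogenize K c F) = Φ + Ψ)
    (hjacF : ∀ b₁ : Fin (m + 2 + 1) → K, b₁ ≠ 0 → eval b₁ F = 0 → (∀ j, eval b₁ (pderiv j F) = 0) → ∀ i, b₁ i = b₁ c * pt i) :
    Theorems.EquisingularLift.ELNatAt p K (m + 1 + 1) H ι := by
  refine elNatAt_of_linSubst_ordinaryPoints_of_jacobian' p hp ι F hF hFp hrange
    (fun i => if i = c then (X c : MvPolynomial (Fin (m + 1 + 1 + 1)) K) else X i + C (-1 * pt i) * X c)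
    (fun i => if i = c then (X c : MvPolynomial (Fin (m + 1 + 1 + 1)) K) else X i + C (1 * pt i) * X c)
    (isHomogeneous_shear c pt (-1)) (isHomogeneous_shear c pt 1) (fun i => ?_) (fun i => ?_) [c] (List.nodup_singleton c) ?_
    (jacobianF_of_proportional c pt [c] (List.mem_singleton_self c) F hjacF)
  · have h := aeval_shear_shear c pt 1 i
    rwa [show (-(1 : K)) = -1 from rfl] at h
  · have h := aeval_shear_shear c pt (-1) i
    rwa [neg_neg] at h
  · intro c' hc'
    rw [List.mem_singleton] at hc'
    subst hc'
    obtain ⟨μ, Φ, Ψ, hμ, hΦ, hns, hΨ, heq⟩ := hordF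
    exact ⟨μ, Φ, Ψ, hμ, hΦ, hns, hΨ, by rw [dehomogenize_shear_eq_translate]; exact heq⟩

end MultiOrd

end Summit.ResolutionOfSingularities.ResolutionOfSingularities.Cruxes.EquisingularLiftNat.Sections

namespace Summit.ResolutionOfSingularities.ResolutionOfSingularities.Cruxes.EquisingularLift.StrataSplit

open Summit.ResolutionOfSingularities.ResolutionOfSingularities.Cruxes.EquisingularLiftNat.Sections

/-- ★★ **A hypersurface whose only singular point is an ordinary multiple point, anywhere, has a regular blow-up model** — `K = K̄`, any characteristic, any
dimension, any degree: hypotheses (ordF) + (jacF) of ✓ `MultiOrd.elNatAt_of_ordinaryPoint_at` at `P = [b]`, `b_{c₀} = 1`; conclusion = that of the open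
residual `stub_blowupModel_ge_five` at `H`.  ✓ `blowupModel_of_range_eq_of_linSubst_ordinaryPoints_of_jacobian'` with the shear.
[cite: Hartshorne1977, I Thm. 5.1, II Example 7.1.1, II Ex. 7.12] -/
theorem blowupModel_of_ordinaryPoint_at {K : Type} [Field K] [IsAlgClosed K] {m : ℕ} {H : Scheme.{0}}
    (ι : H ⟶ (projectiveSpace (m + 1 + 1) K).left) [IsClosedImmersion ι] [IsIntegral H]
    (F : MvPolynomial (Fin (m + 1 + 1 + 1)) K) {d : ℕ} (hF : F.IsHomogeneous d) (hFp : Prime F)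
    (hrange : letI := MvPolynomial.gradedAlgebra (σ := Fin (m + 1 + 1 + 1)) (R := K)
      Set.range ι = {x : Proj (homogeneousSubmodule (Fin (m + 1 + 1 + 1)) K) | F ∈ x.asHomogeneousIdeal})
    (c : Fin (m + 1 + 1 + 1)) (pt : Fin (m + 1 + 1 + 1) → K)
    (hordF : ∃ (μ : ℕ) (Φ Ψ : MvPolynomial (Fin (m + 2)) K), 1 ≤ μ ∧ Φ.IsHomogeneous μ ∧ IsNonsingularForm K Φ ∧
      Ψ ∈ Ideal.span (Set.range (X : Fin (m + 2) → MvPolynomial (Fin (m + 2)) K)) ^ (μ + 1) ∧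
        aeval (fun j : Fin (m + 2) => (X j : MvPolynomial (Fin (m + 2)) K) + C (pt (c.succAbove j))) (ProjectiveSpace.dehomogenize K c F) = Φ + Ψ)
    (hjacF : ∀ b₁ : Fin (m + 2 + 1) → K, b₁ ≠ 0 → eval b₁ F = 0 → (∀ j, eval b₁ (pderiv j F) = 0) → ∀ i, b₁ i = b₁ c * pt i) :
    ∃ 𝔞 : H.IdealSheafData, 𝔞 ≠ ⊥ ∧ ∀ (Z : Scheme.{0}) (π : Z ⟶ H), IsBlowup π 𝔞 → Scheme.IsRegular Z := by
  refine blowupModel_of_range_eq_of_linSubst_ordinaryPoints_of_jacobian' ι F hF hFp hrange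
    (fun i => if i = c then (X c : MvPolynomial (Fin (m + 1 + 1 + 1)) K) else X i + C (-1 * pt i) * X c)
    (fun i => if i = c then (X c : MvPolynomial (Fin (m + 1 + 1 + 1)) K) else X i + C (1 * pt i) * X c)
    (MultiOrd.isHomogeneous_shear c pt (-1)) (MultiOrd.isHomogeneous_shear c pt 1) (fun i => ?_) (fun i => ?_) [c] (List.nodup_singleton c) ?_
    (MultiOrd.jacobianF_of_proportional c pt [c] (List.mem_singleton_self c) F hjacF)
  · have h := MultiOrd.aeval_shear_shear c pt 1 i
    rwa [show (-(1 : K)) = -1 from rfl] at h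
  · have h := MultiOrd.aeval_shear_shear c pt (-1) i
    rwa [neg_neg] at h
  · intro c' hc'
    rw [List.mem_singleton] at hc'
    subst hc'
    obtain ⟨μ, Φ, Ψ, hμ, hΦ, hns, hΨ, heq⟩ := hordF
    exact ⟨μ, Φ, Ψ, hμ, hΦ, hns, hΨ, by rw [MultiOrd.dehomogenize_shear_eq_translate]; exact heq⟩

end Summit.ResolutionOfSingularities.ResolutionOfSingularities.Cruxes.EquisingularLift.StrataSplit

end
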